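import Literature.Geometry.Symplectic.SteinHandlebodies
import HarnessLib

/-!
# Fact-stub `stub_factGompf` of line `exchange-recognition` for crux `ConvexBisection.AcyclicBisectionRigidity`
(item stmt-SmoothPoincare4-10507, route route-SmoothPoincare4-ConvexBisection)

The registered fact-stub G of the lead's skeleton (reshape r1, 2026-08-16): VERBATIM the tree's
named fact `Literature.Geometry.Symplectic.Gompf1998_thm13_indexLE_two` (Gompf 1998, Thm. 1.3
(Eliashberg 1990), compact case, "only if", condition (a): a compact Stein domain carries a Morse
function adapted to its boundary all of whose critical points have index `≤ 2`).  The fact is now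
DISCHARGED in the tree (`Literature.Geometry.Symplectic.Gompf1998_thm13_indexLE_two_holds`,
`SteinHandlebodies.lean`: a `J`-convex Morse perturbation of the defining function,
`SteinStructure.exists_isMorseAdapted_levi_pos`, has interior critical points of index `≤ 2`,
`SteinStructure.isHandlebodyOfIndexLE_two_of_isMorseAdapted`), so this stub closes by `exact`, and
the landed Stub 1 `stub_steinHandleNormalForm : Gompf1998_thm13_indexLE_two → …`
(`Theorems/ConvexBisectionAcyclicBisectionRigidityStubSteinHandleNormalForm.lean`, p90677) becomes
unconditional in the composition `AcyclicBisectionRigidity_of`.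

## References

* R. E. Gompf, *Handlebody construction of Stein surfaces*, Ann. of Math. 148 (1998), Thm. 1.3.
  [Gompf1998]
-/

noncomputable section

-- The namespace is prescribed by the crux protocol (`Summit.<P>.<Sub>.Theorems.<Crux>.<Line>`
-- with `P = Sub = SmoothPoincare4`), hence the duplicated component.
set_option linter.dupNamespace false

namespace Summit.SmoothPoincare4.SmoothPoincare4.Theorems.AcyclicBisectionRigidity.ExchangeRecognition

open Literature.Geometry.Symplectic

/-- **Fact-stub G, discharged**: Gompf 1998 Thm. 1.3 (a) — a compact (Hausdorff, second
countable) Stein domain is a 2-handlebody (`IsHandlebodyOfIndexLE 3 2 W`) — holds, by the tree's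
`Gompf1998_thm13_indexLE_two_holds`. [cite: Gompf1998, Thm. 1.3 (compact case, only if, condition (a))] -/
theorem stub_factGompf : Gompf1998_thm13_indexLE_two := by
  exact Gompf1998_thm13_indexLE_two_holds

end Summit.SmoothPoincare4.SmoothPoincare4.Theorems.AcyclicBisectionRigidity.ExchangeRecognition

end
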